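import Summits.ResolutionOfSingularities.ResolutionOfSingularities.Theorems.FrobeniusClosingPatchingRelPerfectDepthPowerStep
import Summits.ResolutionOfSingularities.ResolutionOfSingularities.Theorems.FrobeniusClosingPatchingRelPerfectDepthOne
import HarnessLib

/-!
# Crux `PatchingRelPerfect` (stmt-ResolutionOfSingularities-16161), chain w52 — the POWER RUNG «R-pow»,
# part 2: package, end, the invariant along a controlled sequence, and the ASSEMBLY

[OURS · L1 W5.2 · rung tool] res-D-pv-054 AS res-L1-w52-stub-6, OFFER 05:50:34Z. Nothing here is a statement of the
manuscript under review; the two printed dimension-three facts (CP 2019 Prop. 4.4, CJS 2020 Thm. 1.4 / 6.9 (a) in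
sequence form B) enter as HYPOTHESES of the final theorems, exactly as in r-d1 (`DepthOneTargets.depthOne`).

THE POWER RUNG. `S` regular local of Krull dimension four (any characteristic, any residue field), `x` a family
spanning `𝔪`, `k ≥ 1`, `e ≥ 0`, `𝔞 ⊆ 𝔪^e` ANY ideal and `J` any ideal with `(x_i^{ek+k})_i ⊆ J ⊆ 𝔪^{ek+k}`. Then

  `I = 𝔞^k + J` is in the companion class `𝒞` (and satisfies the blow-up form of the registered core)

modulo the two facts: on `X = Bl_𝔪 Spec S` one has `I𝒪_X = 𝓘_E^{ek} · (H^k ⊔ 𝓘_E^k)` with `H = (𝔞𝒪_X : 𝓘_E^e)` the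
weight-`e` controlled transform (`DepthPow.powerPackage_model`); r-d1's Θ₃
(`DepthOneTargets.controlledTrivialization₃_of_facts`) trivializes the E-side datum `𝔠 = H|_E` by a WEIGHT-ONE
controlled sequence on the regular excellent threefold `E`; each of its steps is matched in power format by
`DepthPow.powerStep` (part 1; res-D-pv-016's `dictionaryStep_pow` with `μ = k`), `DepthPow.powerInv_along`; at the
end `𝔠' = ⊤` forces `H'^k ⊔ 𝓘_{E'}^k = ⊤` (`DepthPow.isLocallyPrincipal_of_comap_eq_top`; `𝔠 = ⊥` is immediate,
`DepthPow.isLocallyPrincipal_of_comap_eq_bot`), so `I𝒪` is locally principal on a regular closed-point modification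
and D5 `towerContraction_holds` + `atomConclusion_of_companion'` conclude. Members: `(F^k) + 𝔪^{ek+k}` and
`(F^k) + (x_i^{ek+k})` for EVERY `F ∈ 𝔪^e` (arbitrarily singular initial divisor), `𝔞^k + 𝔪^{k(e+1)}` for
non-principal `𝔞`; `k = 1` is r-d1 (take `𝔞 := I`, `e := d`). Rationale: the idealistic exponents `(𝔠^k, k)` and
`(𝔠, 1)` are equivalent (Hironaka 1977), and the power format realises the equivalence on the X-side.

* `DepthPow.idealSheaf_sup`, `DepthPow.powerPackage_model`, `DepthPow.isLocallyPrincipal_of_comap_eq_top`,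
  `DepthPow.isLocallyPrincipal_of_comap_eq_bot`, `DepthPow.powerInv_along`;
* `DepthPow.powerRung_companion` (𝒞-membership) and `DepthPow.powerRung_atom` (the core's blow-up form).

## References

* H. Hironaka, *Idealistic exponents of singularity* (1977), §1. [Hironaka1977]
* J. Kollár, *Lectures on Resolution of Singularities* (2007), (3.111) Step 3. [Kollar2007]
* V. Cossart, O. Piltant, J. Algebra 529 (2019), Prop. 4.4. [CossartPiltant2019]
* V. Cossart, U. Jannsen, S. Saito, LNM 2270 (2020), Thm. 1.4, Thm. 6.9 (a). [CossartJannsenSaito2020]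
* The Stacks Project, Tags 080A, 080B. [StacksProject]
-/

-- `Summit.<Summit>.<Sub>.Theorems` with `Sub = Summit` (single-conjunct summit, D-0017)
set_option linter.dupNamespace false

noncomputable section

open CategoryTheory CategoryTheory.Limits AlgebraicGeometry TopologicalSpace
open Literature.AlgebraicGeometry.Resolution
open IsLocalRing

namespace Summit.ResolutionOfSingularities.ResolutionOfSingularities.Theorems

universe u

namespace DepthPow

/-! ### The dictionary `I ↦ Ĩ` preserves sums -/

/-- `(I ⊔ J)~ = Ĩ ⊔ J̃` on `Spec R` (the dictionary is an order isomorphism onto the ideal sheaves of the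
affine scheme: `affineBlowup.idealSheaf_le_idealSheaf_iff`, `affineBlowup.exists_eq_idealSheaf`). [folklore] -/
theorem idealSheaf_sup {R : Type u} [CommRing R] (I J : Ideal R) :
    affineBlowup.idealSheaf (I ⊔ J) = affineBlowup.idealSheaf I ⊔ affineBlowup.idealSheaf J := by
  apply le_antisymm
  · obtain ⟨L, hL⟩ := affineBlowup.exists_eq_idealSheaf
      (affineBlowup.idealSheaf I ⊔ affineBlowup.idealSheaf J)
    rw [hL, affineBlowup.idealSheaf_le_idealSheaf_iff]
    have hI : I ≤ L := affineBlowup.idealSheaf_le_idealSheaf_iff.mp (hL ▸ le_sup_left)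
    have hJ : J ≤ L := affineBlowup.idealSheaf_le_idealSheaf_iff.mp (hL ▸ le_sup_right)
    exact sup_le hI hJ
  · exact sup_le (affineBlowup.idealSheaf_le_idealSheaf_iff.mpr le_sup_left)
      (affineBlowup.idealSheaf_le_idealSheaf_iff.mpr le_sup_right)

/-! ### The power package at the model `Bl_𝔪 Spec S` -/

section Package

variable {S : Type u} [CommRing S] [IsRegularLocalRing S] {m : ℕ} (y : Fin (m + 1) → S)
  (hy : Ideal.span (Set.range y) = IsLocalRing.maximalIdeal S)
  (hd : (IsLocalRing.maximalIdeal S).spanFinrank = m + 1)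
  {n : ℕ} (x : Fin n → S) (hx : Ideal.span (Set.range x) = IsLocalRing.maximalIdeal S)
  (𝔞 J : Ideal S) (e k : ℕ) (hk : 1 ≤ k) (h𝔞 : 𝔞 ≤ IsLocalRing.maximalIdeal S ^ e)
  (hJ₁ : Ideal.span (Set.range fun i => x i ^ (e * k + k)) ≤ J)
  (hJ₂ : J ≤ IsLocalRing.maximalIdeal S ^ (e * k + k))

local notation3 "Mx" => Ideal.span (Set.range y)
local notation3 "X" => affineBlowup (Ideal.span (Set.range y))
local notation3 "g" => affineBlowup.π (Ideal.span (Set.range y))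
local notation3 "𝓔" => (affineBlowup.idealSheaf (Ideal.span (Set.range y))).comap
  (affineBlowup.π (Ideal.span (Set.range y)))
local notation3 "H" => controlledTransform (affineBlowup.π (Ideal.span (Set.range y)))
  (affineBlowup.idealSheaf (Ideal.span (Set.range y))) (affineBlowup.idealSheaf 𝔞) e

include hy hx hk h𝔞 hJ₁ hJ₂ in
/-- **The POWER FORMAT on the first blow-up**: `(𝔞^k + J)𝒪_X = 𝓘_E^{ek} · (H^k ⊔ 𝓘_E^k)` with
`H = (𝔞𝒪_X : 𝓘_E^e)` (`𝔞𝒪_X = 𝓘_E^e · H` by BGMW Lemma 3.2.1 with exponent `e`, `J𝒪_X = 𝓘_E^{ek+k}` by the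
sandwich `(x_i^{ek+k}) ⊆ J ⊆ 𝔪^{ek+k}` and `DepthOne.comap_idealSheaf_span_powers_eq_pow`).
[cite: BierstoneGrigorievMilmanWlodarczyk2011, §3.2 Lemma 3.2.1] [cite: GortzWedhorn2020, Prop. 13.91 (1)] -/
theorem powerFormat_model :
    (affineBlowup.idealSheaf (𝔞 ^ k ⊔ J)).comap (g) = (𝓔) ^ (e * k) * ((H) ^ k ⊔ (𝓔) ^ k) := by
  have hg : IsBlowup (g) (affineBlowup.idealSheaf (Mx)) := affineBlowup.isBlowup (Mx)
  have h𝔪 : Ideal.span (Set.range x) = Mx := hx.trans hy.symm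
  -- `𝔞𝒪 = 𝓘_E^e · H`
  have h𝔞le : (affineBlowup.idealSheaf 𝔞).comap (g) ≤ (𝓔) ^ e := by
    rw [← comap_pow, ← DepthOne.idealSheaf_pow]
    exact Scheme.IdealSheafData.comap_mono _ (affineBlowup.idealSheaf_le_idealSheaf_iff.mpr (hy ▸ h𝔞))
  have h𝔞H : (𝓔) ^ e * (H) = (affineBlowup.idealSheaf 𝔞).comap (g) := hg.pow_mul_controlledTransform_eq h𝔞le
  -- `J𝒪 = 𝓘_E^{ek+k}`
  have hJ : (affineBlowup.idealSheaf J).comap (g) = (𝓔) ^ (e * k + k) := by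
    apply le_antisymm
    · rw [← comap_pow, ← DepthOne.idealSheaf_pow]
      exact Scheme.IdealSheafData.comap_mono _ (affineBlowup.idealSheaf_le_idealSheaf_iff.mpr (hy ▸ hJ₂))
    · rw [← DepthOne.comap_idealSheaf_span_powers_eq_pow x h𝔪 hg (by omega : 1 ≤ e * k + k)]
      exact Scheme.IdealSheafData.comap_mono _ (affineBlowup.idealSheaf_le_idealSheaf_iff.mpr hJ₁)
  rw [idealSheaf_sup, Scheme.IdealSheafData.comap_sup, DepthOne.idealSheaf_pow, comap_pow, ← h𝔞H, hJ,
    mul_pow, ← pow_mul, pow_add]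
  exact (mul_add _ _ _).symm

include hy hd hx hk h𝔞 hJ₁ hJ₂ in
/-- **The power package at the model** `X = Bl_𝔪 Spec S ⊃ E = V(𝔪𝒪_X)`, `i = subschemeι`, `M = 𝓘_E^{ek}`,
`H = (𝔞𝒪_X : 𝓘_E^e)`, `𝔠 = H|_E`: every field of the X-side invariant (res-L1-w52-stub-3's p494999 /
res-D-pv-055's model lemmas) together with the power format, and `E` integral, Noetherian, excellent of dimension
`m`. [cite: Liu2002, Thm. 8.1.19 (a), (b)] [cite: Kollar2007, (3.111) Step 3] -/
theorem powerPackage_model :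
    IsNoetherian (X) ∧ Scheme.IsRegular (X) ∧ Scheme.IsRegular (𝓔).subscheme ∧
      IsClosedImmersion (𝓔).subschemeι ∧ IsEffectiveCartier (𝓔).subschemeι.ker ∧
      (∀ e' : (𝓔).subscheme, (g).base ((𝓔).subschemeι.base e') = IsLocalRing.closedPoint S) ∧
      (∃ K₀ : (Spec (.of S)).IdealSheafData, IsBlowup (g) K₀ ∧
        (K₀.support : Set (Spec (.of S))) ⊆ {IsLocalRing.closedPoint S}) ∧
      IsEffectiveCartier ((𝓔) ^ (e * k)) ∧
      (affineBlowup.idealSheaf (𝔞 ^ k ⊔ J)).comap (g) =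
        (𝓔) ^ (e * k) * ((H) ^ k ⊔ (𝓔).subschemeι.ker ^ k) ∧
      IsIntegral (𝓔).subscheme ∧ IsNoetherian (𝓔).subscheme ∧ Scheme.IsExcellent (𝓔).subscheme ∧
      topologicalKrullDim (𝓔).subscheme = m := by
  refine ⟨DepthOne.isNoetherian_blowup y, DepthOne.isRegular_blowup y hy, DepthOne.isRegular_exceptional y hy hd,
    inferInstance, DepthOne.ker_subschemeι_isEffectiveCartier y, DepthOne.map_exceptional_eq_closedPoint y hy,
    ⟨_, affineBlowup.isBlowup (Mx), DepthOne.support_idealSheaf_span_subset y hy⟩,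
    (affineBlowup.isBlowup (Mx)).isEffectiveCartier.pow _, ?_, DepthOne.isIntegral_exceptional y hy hd,
    DepthOne.isNoetherian_exceptional y, DepthOne.isExcellent_exceptional y hy,
    DepthOne.topologicalKrullDim_exceptional y hy hd⟩
  rw [Scheme.IdealSheafData.ker_subschemeι]
  exact powerFormat_model y hy x hx 𝔞 J e k hk h𝔞 hJ₁ hJ₂

end Package

/-! ### The two ends of the power dictionary -/

/-- **End, unit branch**: in power format `I𝒪_X = M · (H^k ⊔ 𝓘_E^k)` with `H|_E = ⊤`, the residual ideal is the
unit ideal (`V(H^k ⊔ 𝓘_E^k) ⊆ V(H) ∩ E = V(H|_E) = ∅`), so `I𝒪_X = M` is locally principal.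
[cite: GortzWedhorn2020, (13.19)] -/
theorem isLocallyPrincipal_of_comap_eq_top {S : Type u} [CommRing S] (I : Ideal S) {k : ℕ} (hk : 1 ≤ k)
    {E X : Scheme.{u}} (i : E ⟶ X) [IsClosedImmersion i] (g : X ⟶ Spec (.of S)) (M H : X.IdealSheafData)
    (hM : IsEffectiveCartier M) (hH : H.comap i = ⊤)
    (hfmt : (affineBlowup.idealSheaf I).comap g = M * (H ^ k ⊔ i.ker ^ k)) :
    IsLocallyPrincipal ((affineBlowup.idealSheaf I).comap g) := by
  have hK : H ^ k ⊔ i.ker ^ k = ⊤ := by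
    rw [← Scheme.IdealSheafData.support_eq_bot_iff, eq_bot_iff]
    intro z hz
    have hz' : z ∈ ((i.ker ^ k).support : Set X) :=
      Scheme.IdealSheafData.support_antitone (le_sup_right (a := H ^ k)) hz
    rw [Scheme.IdealSheafData.support_pow i.ker k (by omega), Scheme.Hom.support_ker,
      i.isClosedEmbedding.isClosed_range.closure_eq] at hz'
    obtain ⟨e', rfl⟩ := hz'
    have he : e' ∈ (((H ^ k ⊔ i.ker ^ k).comap i).support : Set E) := by
      rw [Scheme.IdealSheafData.support_comap]
      exact hz
    have htop : (H ^ k ⊔ i.ker ^ k).comap i = ⊤ := by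
      rw [comap_powerFormat i H hk, hH, ← Scheme.IdealSheafData.one_eq_top, one_pow]
    rw [htop, Scheme.IdealSheafData.support_top] at he
    exact he
  rw [hfmt, hK, Scheme.IdealSheafData.mul_top]
  exact hM.isLocallyPrincipal

/-- **End, zero branch**: in power format with `H|_E = 0`, `H ≤ 𝓘_E` (`comap_eq_bot_iff_le_ker'`), hence
`H^k ⊔ 𝓘_E^k = 𝓘_E^k` and `I𝒪_X = M · 𝓘_E^k` is locally principal. [cite: GortzWedhorn2020, (13.19)] -/
theorem isLocallyPrincipal_of_comap_eq_bot {S : Type u} [CommRing S] (I : Ideal S) (k : ℕ)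
    {E X : Scheme.{u}} (i : E ⟶ X) (g : X ⟶ Spec (.of S)) (M H : X.IdealSheafData)
    (hM : IsEffectiveCartier M) (hiE : IsEffectiveCartier i.ker) (hH : H.comap i = ⊥)
    (hfmt : (affineBlowup.idealSheaf I).comap g = M * (H ^ k ⊔ i.ker ^ k)) :
    IsLocallyPrincipal ((affineBlowup.idealSheaf I).comap g) := by
  have hle : H ≤ i.ker := (DepthOneTargets.comap_eq_bot_iff_le_ker' H i).mp hH
  have hK : H ^ k ⊔ i.ker ^ k = i.ker ^ k := sup_eq_right.mpr (pow_mono hle k)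
  rw [hfmt, hK]
  exact hM.isLocallyPrincipal.mul (hiE.pow k).isLocallyPrincipal

/-! ### The power invariant travels along a weight-one controlled sequence -/

/-- **The power invariant along a controlled sequence** (induction on r-d1's `IsControlledSeq`, one
`DepthPow.powerStep` per blowing up). [folklore] -/
theorem powerInv_along {S : Type u} [CommRing S] [IsRegularLocalRing S] (I : Ideal S) {k : ℕ} (hk : 1 ≤ k)
    {E' E : Scheme.{u}} {ρ : E' ⟶ E} {𝔠 : E.IdealSheafData} {𝔠' : E'.IdealSheafData}
    (h : DepthOneTargets.IsControlledSeq ρ 𝔠 𝔠') :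
    ∀ (X : Scheme.{u}) (i : E ⟶ X) (g : X ⟶ Spec (.of S)) (M H : X.IdealSheafData),
      IsNoetherian X → Scheme.IsRegular X → Scheme.IsRegular E → IsClosedImmersion i →
      IsEffectiveCartier i.ker → (∀ e : E, g.base (i.base e) = IsLocalRing.closedPoint S) →
      (∃ K₀ : (Spec (.of S)).IdealSheafData, IsBlowup g K₀ ∧
        (K₀.support : Set (Spec (.of S))) ⊆ {IsLocalRing.closedPoint S}) →
      IsEffectiveCartier M → H.comap i = 𝔠 →
      (affineBlowup.idealSheaf I).comap g = M * (H ^ k ⊔ i.ker ^ k) →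
      ∃ (X' : Scheme.{u}) (i' : E' ⟶ X') (g' : X' ⟶ Spec (.of S)) (M' H' : X'.IdealSheafData),
        IsNoetherian X' ∧ Scheme.IsRegular X' ∧ Scheme.IsRegular E' ∧ IsClosedImmersion i' ∧
        IsEffectiveCartier i'.ker ∧
        (∀ e : E', g'.base (i'.base e) = IsLocalRing.closedPoint S) ∧
        (∃ K₀ : (Spec (.of S)).IdealSheafData, IsBlowup g' K₀ ∧
          (K₀.support : Set (Spec (.of S))) ⊆ {IsLocalRing.closedPoint S}) ∧
        IsEffectiveCartier M' ∧ H'.comap i' = 𝔠' ∧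
        (affineBlowup.idealSheaf I).comap g' = M' * (H' ^ k ⊔ i'.ker ^ k) := by
  induction h with
  | nil 𝔠₀ =>
      intro X i g M H hN hX hE hi hiE hpt hg hM hH hfmt
      exact ⟨X, i, g, M, H, hN, hX, hE, hi, hiE, hpt, hg, hM, hH, hfmt⟩
  | cons τ ρ₀ 𝔠₀ 𝔠₁ 𝔠₂ C hseq hC hle hτ hctrl ih =>
      intro X i g M H hN hX hE hi hiE hpt hg hM hH hfmt
      obtain ⟨X₁, i₁, g₁, M₁, H₁, hN₁, hX₁, hE₁, hi₁, hiE₁, hpt₁, hg₁, hM₁, hH₁, hfmt₁⟩ :=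
        ih X i g M H hN hX hE hi hiE hpt hg hM hH hfmt
      haveI := hN₁
      haveI := hi₁
      rw [← hH₁] at hle hctrl
      obtain ⟨X₂, i₂, g₂, M₂, H₂, hN₂, hX₂, hE₂, hi₂, hiE₂, hpt₂, hg₂, hM₂, hH₂, hfmt₂⟩ :=
        powerStep I hk i₁ g₁ hX₁ hE₁ hiE₁ hpt₁ hg₁ M₁ H₁ hM₁ hfmt₁ τ C 𝔠₂ hC hle hτ hctrl
      exact ⟨X₂, i₂, g₂, M₂, H₂, hN₂, hX₂, hE₂, hi₂, hiE₂, hpt₂, hg₂, hM₂, hH₂, hfmt₂⟩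

/-! ### The assembly -/

/-- **THE POWER RUNG, companion form (`𝒞`-membership)**: for `S` regular local of Krull dimension four, `x`
spanning `𝔪`, `k ≥ 1`, `𝔞 ⊆ 𝔪^e` any ideal and `(x_i^{ek+k})_i ⊆ J ⊆ 𝔪^{ek+k}`, the ideal `I = 𝔞^k + J ≠ 0` admits
an `𝔪`-primary-or-unit `Q` (`𝔪^m ≤ Q`) with a REGULAR blowing up of `Spec S` along `(I·Q)~` — modulo CP 2019
Prop. 4.4 and CJS 2020 Thm. 1.4 / 6.9 (a) (sequence form B), taken as hypotheses; perfectness / characteristic /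
completeness are used nowhere. [cite: CossartPiltant2019, Prop. 4.4] [cite: CossartJannsenSaito2020, Thm. 1.4, Thm. 6.9 (a)]
[cite: Kollar2007, (3.111) Step 3] [cite: StacksProject, Tag 080A] -/
theorem powerRung_companion (hCP : CossartPiltant2019Principalization.{u})
    (hCJS : CossartJannsenSaito2020EmbeddedSequenceB.{u})
    (S : Type u) [CommRing S] [IsRegularLocalRing S] (hdim : ringKrullDim S = (4 : ℕ))
    {n : ℕ} (x : Fin n → S) (hx : Ideal.span (Set.range x) = IsLocalRing.maximalIdeal S)
    (k e : ℕ) (hk : 1 ≤ k) (𝔞 J : Ideal S) (h𝔞 : 𝔞 ≤ IsLocalRing.maximalIdeal S ^ e)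
    (hJ₁ : Ideal.span (Set.range fun i => x i ^ (e * k + k)) ≤ J)
    (hJ₂ : J ≤ IsLocalRing.maximalIdeal S ^ (e * k + k))
    (I : Ideal S) (hI : I = 𝔞 ^ k ⊔ J) (hI0 : I ≠ ⊥) :
    ∃ (Q : Ideal S) (m : ℕ), IsLocalRing.maximalIdeal S ^ m ≤ Q ∧
      ∃ (B : Scheme.{u}) (b : B ⟶ Spec (.of S)),
        IsBlowup b (affineBlowup.idealSheaf (I * Q)) ∧ Scheme.IsRegular B := by
  subst hI
  obtain ⟨hd, y, hy⟩ := DepthOne.exists_rsop_four hdim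
  obtain ⟨hN, hX, hE, hi, hiE, hpt, hg, hM, hfmt, hint, hnoeth, hexc, hdimE⟩ :=
    powerPackage_model y hy hd x hx 𝔞 J e k hk h𝔞 hJ₁ hJ₂
  -- shorthand for the model data
  set Mx := Ideal.span (Set.range y) with hMx
  set g₀ := affineBlowup.π Mx
  set 𝓔 := (affineBlowup.idealSheaf Mx).comap g₀
  set H₀ := controlledTransform g₀ (affineBlowup.idealSheaf Mx) (affineBlowup.idealSheaf 𝔞) e
  haveI := hN
  have key : ∃ (X' : Scheme.{u}) (g' : X' ⟶ Spec (.of S)),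
      (∃ K₀ : (Spec (.of S)).IdealSheafData, IsBlowup g' K₀ ∧
        (K₀.support : Set (Spec (.of S))) ⊆ {IsLocalRing.closedPoint S}) ∧
      Scheme.IsRegular X' ∧ IsLocallyPrincipal ((affineBlowup.idealSheaf (𝔞 ^ k ⊔ J)).comap g') := by
    by_cases h𝔠 : H₀.comap 𝓔.subschemeι = ⊥
    · exact ⟨_, g₀, hg, hX,
        isLocallyPrincipal_of_comap_eq_bot (𝔞 ^ k ⊔ J) k 𝓔.subschemeι g₀ _ H₀ hM hiE h𝔠 hfmt⟩
    · haveI := hint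
      haveI := hnoeth
      have hdim3 : topologicalKrullDim 𝓔.subscheme = 3 := by rw [hdimE]; rfl
      obtain ⟨E', ρ, hρ⟩ :=
        DepthOneTargets.controlledTrivialization₃_of_facts hCP hCJS 𝓔.subscheme hE hexc hdim3 _ h𝔠
      obtain ⟨X', i', g', M', H', -, hX', -, hi', -, -, hg', hM', hH', hfmt'⟩ :=
        powerInv_along (𝔞 ^ k ⊔ J) hk hρ _ 𝓔.subschemeι g₀ _ H₀ hN hX hE hi hiE hpt hg hM rfl hfmt
      haveI := hi'
      exact ⟨X', g', hg', hX', isLocallyPrincipal_of_comap_eq_top (𝔞 ^ k ⊔ J) hk i' g' M' H' hM' hH' hfmt'⟩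
  obtain ⟨X', g', ⟨K₀, hg', hK₀⟩, hX', hlp⟩ := key
  exact DepthOneTargets.towerContraction_holds S (𝔞 ^ k ⊔ J) hI0 X' g' K₀ hg' hK₀ hX' hlp

/-- **THE POWER RUNG in the registered core's blow-up form** (`stub_atomDimFourBlowup`'s conclusion, with NONE of
the core's extra hypotheses): every blowing up `T → Spec S` along `I = 𝔞^k + J` as above carries a non-zero ideal
sheaf cosupported in the closed fibre whose blowing up is regular — modulo the two printed dimension-three facts.
[cite: CossartPiltant2019, Prop. 4.4] [cite: CossartJannsenSaito2020, Thm. 1.4, Thm. 6.9 (a)]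
[cite: StacksProject, Tag 080A] -/
theorem powerRung_atom (hCP : CossartPiltant2019Principalization.{u})
    (hCJS : CossartJannsenSaito2020EmbeddedSequenceB.{u})
    (S : Type u) [CommRing S] [IsRegularLocalRing S] (hdim : ringKrullDim S = (4 : ℕ))
    {n : ℕ} (x : Fin n → S) (hx : Ideal.span (Set.range x) = IsLocalRing.maximalIdeal S)
    (k e : ℕ) (hk : 1 ≤ k) (𝔞 J : Ideal S) (h𝔞 : 𝔞 ≤ IsLocalRing.maximalIdeal S ^ e)
    (hJ₁ : Ideal.span (Set.range fun i => x i ^ (e * k + k)) ≤ J)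
    (hJ₂ : J ≤ IsLocalRing.maximalIdeal S ^ (e * k + k))
    (I : Ideal S) (hI : I = 𝔞 ^ k ⊔ J) (hI0 : I ≠ ⊥)
    (T : Scheme.{u}) (f : T ⟶ Spec (.of S)) (hf : IsBlowup f (affineBlowup.idealSheaf I)) :
    ∃ (J' : T.IdealSheafData) (T' : Scheme.{u}) (π : T' ⟶ T), J' ≠ ⊥ ∧
      (∀ t : T, t ∈ J'.support → f.base t = IsLocalRing.closedPoint S) ∧
      IsBlowup π J' ∧ Scheme.IsRegular T' :=
  atomConclusion_of_companion' hI0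
    (powerRung_companion hCP hCJS S hdim x hx k e hk 𝔞 J h𝔞 hJ₁ hJ₂ I hI hI0) T f hf

/-! ### The headline members `(F^k) + 𝔪^{ek+k}` -/

/-- **Every `(F^k) + 𝔪^{ek+k}` is in the companion class** (`F ∈ 𝔪^e` arbitrary — the initial divisor `V(F̄) ⊂ E`
may be as singular as one likes —, `k ≥ 1`, `S` regular local of Krull dimension four, any characteristic, any
residue field), modulo the two printed dimension-three facts: the case `𝔞 = (F)`, `J = 𝔪^{ek+k}` of
`powerRung_companion`. [cite: CossartPiltant2019, Prop. 4.4] [cite: CossartJannsenSaito2020, Thm. 1.4, Thm. 6.9 (a)]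
[cite: Hironaka1977, §1] -/
theorem span_pow_sup_maximalIdeal_pow_companion (hCP : CossartPiltant2019Principalization.{u})
    (hCJS : CossartJannsenSaito2020EmbeddedSequenceB.{u})
    (S : Type u) [CommRing S] [IsRegularLocalRing S] (hdim : ringKrullDim S = (4 : ℕ))
    (k e : ℕ) (hk : 1 ≤ k) (F : S) (hF : F ∈ IsLocalRing.maximalIdeal S ^ e) :
    ∃ (Q : Ideal S) (m : ℕ), IsLocalRing.maximalIdeal S ^ m ≤ Q ∧
      ∃ (B : Scheme.{u}) (b : B ⟶ Spec (.of S)),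
        IsBlowup b (affineBlowup.idealSheaf
          ((Ideal.span {F ^ k} ⊔ IsLocalRing.maximalIdeal S ^ (e * k + k)) * Q)) ∧ Scheme.IsRegular B := by
  obtain ⟨hd, y, hy⟩ := DepthOne.exists_rsop_four hdim
  -- `𝔪 ≠ 0` (its minimal number of generators is four), so `𝔪^{ek+k} ≠ 0` in the domain `S`
  haveI : IsDomain S := isDomain_of_isRegularLocalRing S
  have h𝔪 : IsLocalRing.maximalIdeal S ≠ ⊥ := by
    intro h
    rw [h, Submodule.spanFinrank_bot] at hd
    omega
  have hI0 : Ideal.span {F ^ k} ⊔ IsLocalRing.maximalIdeal S ^ (e * k + k) ≠ ⊥ := fun h =>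
    pow_ne_zero _ h𝔪 (le_bot_iff.mp (h ▸ le_sup_right))
  have hJ₁ : Ideal.span (Set.range fun i => y i ^ (e * k + k)) ≤ IsLocalRing.maximalIdeal S ^ (e * k + k) := by
    rw [Ideal.span_le]
    rintro _ ⟨i, rfl⟩
    exact Ideal.pow_mem_pow (hy ▸ Ideal.subset_span ⟨i, rfl⟩) _
  have h := powerRung_companion hCP hCJS S hdim y hy k e hk (Ideal.span {F})
    (IsLocalRing.maximalIdeal S ^ (e * k + k)) ((Ideal.span_singleton_le_iff_mem _).mpr hF) hJ₁ le_rfl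
    _ rfl (by rwa [Ideal.span_singleton_pow])
  rwa [Ideal.span_singleton_pow] at h

/-- **… and in the core's blow-up form.** [cite: CossartPiltant2019, Prop. 4.4]
[cite: CossartJannsenSaito2020, Thm. 1.4, Thm. 6.9 (a)] [cite: StacksProject, Tag 080A] -/
theorem span_pow_sup_maximalIdeal_pow_atom (hCP : CossartPiltant2019Principalization.{u})
    (hCJS : CossartJannsenSaito2020EmbeddedSequenceB.{u})
    (S : Type u) [CommRing S] [IsRegularLocalRing S] (hdim : ringKrullDim S = (4 : ℕ))
    (k e : ℕ) (hk : 1 ≤ k) (F : S) (hF : F ∈ IsLocalRing.maximalIdeal S ^ e)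
    (T : Scheme.{u}) (f : T ⟶ Spec (.of S))
    (hf : IsBlowup f (affineBlowup.idealSheaf (Ideal.span {F ^ k} ⊔ IsLocalRing.maximalIdeal S ^ (e * k + k)))) :
    ∃ (J' : T.IdealSheafData) (T' : Scheme.{u}) (π : T' ⟶ T), J' ≠ ⊥ ∧
      (∀ t : T, t ∈ J'.support → f.base t = IsLocalRing.closedPoint S) ∧
      IsBlowup π J' ∧ Scheme.IsRegular T' := by
  haveI : IsDomain S := isDomain_of_isRegularLocalRing S
  obtain ⟨hd, y, hy⟩ := DepthOne.exists_rsop_four hdim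
  have h𝔪 : IsLocalRing.maximalIdeal S ≠ ⊥ := by
    intro h
    rw [h, Submodule.spanFinrank_bot] at hd
    omega
  have hI0 : Ideal.span {F ^ k} ⊔ IsLocalRing.maximalIdeal S ^ (e * k + k) ≠ ⊥ := fun h =>
    pow_ne_zero _ h𝔪 (le_bot_iff.mp (h ▸ le_sup_right))
  exact atomConclusion_of_companion' hI0
    (span_pow_sup_maximalIdeal_pow_companion hCP hCJS S hdim k e hk F hF) T f hf

end DepthPow

end Summit.ResolutionOfSingularities.ResolutionOfSingularities.Theorems

end
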